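/-
Copyright: public-domain mathematics; typed transcription for the H21 Literature library (cell lit-balaban,
writer seat p40 gen 11 = literature-prover-lit-balaban-p40-g11-0).

statement-level skeleton of published theorems with citation tags; proofs where landed; nothing here is a claim about the Yang–Mills mass gap

(Every declaration below is a theorem — no new definitions, no named facts.)

# Bałaban, *Propagators for lattice gauge theories in a background field*, Commun. Math. Phys. **99** (1985)
# 389–434 — p. 394, the paragraph after (3.24): R is expressed through operators with Dirichlet boundary
# conditions on an auxiliary domain Ω₀ ⊃ Ω₁, and the choice of Ω₀ is immaterial.

THE PRINTED SENTENCES ([B9] p. 394, verbatim): «where R = R(U) is an orthogonal projection in the Hilbert space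
L²(Ω₀, 𝔤) onto the subspace ℛ = Δ^η_U N(Q′), N(Q′) = {λ : Q′λ = 0}. (3.21)»; «The operator Δ^η_U↾Ω₀ is the covariant
Laplace operator with Dirichlet boundary conditions on Ω₀^c. Let us elaborate this point a little bit more. By the
definition of space N(Q′) the functions λ in (3.22) vanish on Ω₁^c. This permits us to express R in terms of operators
with some boundary conditions outside Ω₁. We will use only Dirichlet boundary conditions. Let us introduce a domain Ω₀
such that Ω₁ ⊂ Ω₀ and Ω₀ is a union of big blocks of the lattice T₁, e.g. we may take Ω₀ = {a union of big blocks in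
T₁, with distances to Ω₁ ≤ RM}, or we may add to Ω₁ a thinner layer of the big blocks surrounding Ω₁. For such Ω₀ we
consider the operator Δ′_a with Dirichlet boundary conditions on ∂Ω₀, i.e. the operator Δ′_a↾Ω₀ = Ω₀Δ′_aΩ₀. In the
last expression Ω₀ denotes a characteristic function of Ω₀»; «All operators we will consider will be defined by
using Dirichlet boundary conditions on Ω₀. Usually we will not mention it, and we do not indicate this fact in our
notations.»; and p. 393: «thus we have Ω₀ ⊃ Ω₁ ⊃ ⋯ ⊃ Ω_k, Ω_j ⊂ T_η, and we define
Λ_j = Ω_j^{(j)} ∖ Ω_{j+1}^{(j)}, j = 0, 1, …, k, Ω_{k+1} = ∅, or Ω_j ∖ Ω_{j+1} = B^j(Λ_j), hence Λ_j ⊂ T^{(j)}_{L^jη}.»,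
«We have introduced the domain Ω₀ because we will consider operators with Dirichlet boundary conditions on Ω₀^c.»,
«where Q′λ is defined on 𝔅 = ⋃_{j=0}^{k} Λ_j by the formulas (Q′λ)(y) = (Q′_j(U)λ)(y) for y ∈ Λ_j, (3.18)»,
«(Q′_j(U)λ)(y) = … = Σ_{x∈B^j(y)} L^{−jd} R(U(Γ^{(j)}_{y,x}))λ(x), y ∈ T^{(j)}_{L^jη}. (3.19)» (so on Λ₀ = Ω₀ ∖ Ω₁, a
union of 0-blocks B⁰(y) = {y} with trivial contours and weight L⁰ = 1, (Q′λ)(y) = λ(y): every λ ∈ N(Q′) vanishes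
on Ω₀ ∖ Ω₁).

WHAT IS PROVED (the mathematical content of «This permits us to express R in terms of operators with some boundary
conditions outside Ω₁» + «we do not indicate this fact in our notations»: the projection R of (3.20)–(3.21), built in
L²(Ω₀, 𝔤) from the Dirichlet operator Ω₀Δ_TΩ₀, is — read back on the whole lattice T_η through «Ω₀ = characteristic
function» — one and the same operator for every admissible Ω₀).  Carriers: the cell's ℓ² spaces
`PiLp 2 (T → V)`, `PiLp 2 (↥Ω₀ → V)`; Ω₀λ = `B9Eq323DirichletSplit.extS`, f↾Ω₀ = `B9Eq323DirichletSplit.resS`;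
Ω₀Δ_TΩ₀ on L²(Ω₀, 𝔤) = `resS ∘ₗ Δ_T ∘ₗ extS` (`B9Eq323DirichletSplit.resS_lapL_extS` identifies it with the carrier
Laplacian plus exit masses); ℛ = `B9Eq325Proj.lapKer`; R = Mathlib's `Submodule.starProjection` onto ℛ ((3.21) as
stated) and, under the printed inputs `B9Eq325Proj.Data`, the (3.25) operator `B9Eq325Proj.R325`
(`B9Eq325Proj.Data.starProjection_eq_R325`).
* §1 `inner_extS_left/right` — Ω₀ (extension by zero) and ↾Ω₀ (restriction) are mutually adjoint;
  `extS_resS_of_support`.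
* §2 `extS_starProjection_resS` — for ANY subspace W ⊂ L²(Ω₀, 𝔤): Ω₀ ∘ P_W ∘ ↾Ω₀ = P_{Ω₀W}, the orthogonal projection
  of L²(T_η, 𝔤) onto W extended by zero (Hilbert-space lemma: conjugating a projection by an isometry).
* §3 `map_extS_lapKer_dirichlet` — if Δ_T(Ω₀λ) is supported in Ω₀ for every λ ∈ N(Q′) («the functions λ … vanish on
  Ω₁^c» + Ω₀ ⊇ Ω₁ plus a layer), then Ω₀ℛ = Ω₀(Ω₀Δ_TΩ₀ N(Q′)) = Δ_T(Ω₀N(Q′)); hence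
  (`extS_starProjection_resS_dirichlet`, `extS_R325_resS_dirichlet`) Ω₀ ∘ R ∘ ↾Ω₀ = P_{Δ_T(Ω₀N(Q′))} on L²(T_η, 𝔤).
* §4 `starProjection_dirichlet_indep`, `R325_dirichlet_indep` — two admissible domains Ω₀, Ω₀′ whose spaces N(Q′),
  extended by zero, coincide on T_η give the same operator Ω₀R↾Ω₀ = Ω₀′R′↾Ω₀′; `map_extS_ker_eq` and
  `R325_dirichlet_indep_of_constraints` reduce the coincidence to «Q′λ = 0 ⟺ the T_η-constraints Q_T vanish on Ω₀λ»
  plus «every solution of Q_Tμ = 0 vanishes off Ω₁ ⊂ Ω₀».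
* §5 the hypotheses on the cell's lattice carriers (`B9Thm311Lattice.lapL`, `qL`): `lapL_extS_apply_eq_zero_of_layer`
  (Δ_T(Ω₀λ) = 0 off Ω₀ when λ vanishes on Ω₀ ∖ Ω₁ and no bond joins Ω₁ to T ∖ Ω₀), `apply_eq_zero_of_qL_singleton`
  (a 0-block {x} of Q′ forces λ(x) = 0), `qL_extS_apply_of_compat`/`qL_extS_apply_of_offRange`/`qL_ker_iff_of_compat`
  (the Ω₀-block averages of λ vanish iff the T_η-block averages of Ω₀λ vanish, when the Ω₀-blocks are the T_η-blocks
  inside Ω₀ and the remaining T_η-blocks are single sites off Ω₀), and the assembled statements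
  `R325_dirichlet_indep_lattice` (averagings with prescribed null spaces) and `R325_dirichlet_indep_blocks` (the
  cell's `qL` on both domains, Q′\* = the adjoint).

* §6 (v1.1, append-only) the exponent of (3.20) «(3.17) = exp(−(1/2α)‖RD\*A‖²)» read on T_η: `norm_extS` (Ω₀ is an
  isometry), `norm_R325_resS_dirichlet` (‖R(f↾Ω₀)‖_{L²(Ω₀,𝔤)} = ‖P_{Δ_T(Ω₀N(Q′))}f‖_{L²(T_η,𝔤)}),
  `norm_R325_resS_indep_of_constraints` / `norm_R325_resS_indep_lattice` (the exponent does not depend on the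
  admissible Ω₀).

VERSIONS.  v1.0 = p317782 (§§1–5).  v1.1 (p40 gen 11, append-only): §6; §§1–5 byte-identical.  v1.2 (p40 gen 12,
docstring only): page-1 framing sentence now the cell's verbatim line (REFEREE-3 note N-g43-1, ref-2 g54 N1); every
declaration byte-identical to v1.1.

HONEST SCOPE.  Finite-dimensional linear algebra on the cell's typed carriers; the multi-level structure of 𝔅 enters
only through the abstract block data (index type, blocks, contours, weights) exactly as in `B9Thm311Lattice`; the
existence of the printed inverses (Theorem 3.11) is a hypothesis (`B9Eq325Proj.Data`), never asserted.  No measure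
theory, no bounds.  Nothing about (3.26) ff.
-/
import Mathlib
import Literature.MathematicalPhysics.QuantumFieldTheory.Balaban1983to89.B9Eq323DirichletSplit
import Literature.MathematicalPhysics.QuantumFieldTheory.Balaban1983to89.B9Eq325Proj

namespace Literature.MathematicalPhysics.QuantumFieldTheory.Balaban1983to89.B9Eq321DirichletIndependence

open Finset
open Literature.MathematicalPhysics.QuantumFieldTheory.Balaban1983to89.B9Eq323Ker
  Literature.MathematicalPhysics.QuantumFieldTheory.Balaban1983to89.B9Thm311Lattice
  Literature.MathematicalPhysics.QuantumFieldTheory.Balaban1983to89.B9Eq325Proj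
  Literature.MathematicalPhysics.QuantumFieldTheory.Balaban1983to89.B8Eq194CriterionCurved
  Literature.MathematicalPhysics.QuantumFieldTheory.Balaban1983to89.B9Eq323DirichletSplit
open scoped InnerProductSpace

variable {Xt : Type*} {V : Type*} [NormedAddCommGroup V] [InnerProductSpace ℝ V] [Fintype Xt] [DecidableEq Xt]
variable (S : Finset Xt)

/-! ## §1  Ω₀ and ↾Ω₀ are adjoint; Ω₀(f↾Ω₀) = f for f supported in Ω₀ -/

/-- ⟨Ω₀λ, g⟩_{L²(T_η,𝔤)} = ⟨λ, g↾Ω₀⟩_{L²(Ω₀,𝔤)}: extension by zero and restriction are mutually adjoint.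
[cite: Balaban1985BackgroundPropagators, (3.23) p. 394] -/
theorem inner_extS_left (f : PiLp 2 (fun _ : ↥S => V)) (g : PiLp 2 (fun _ : Xt => V)) :
    ⟪extS S f, g⟫_ℝ = ⟪f, resS S g⟫_ℝ := by
  have h0 : ∀ z ∈ (univ : Finset Xt), z ∉ S → ⟪extS S f z, g z⟫_ℝ = 0 := fun z _ hz => by
    rw [extS_apply_of_not_mem S f hz, inner_zero_left]
  rw [PiLp.inner_apply, PiLp.inner_apply, ← Finset.sum_subset (subset_univ S) h0, ← Finset.sum_coe_sort]
  refine Finset.sum_congr rfl fun x _ => ?_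
  show ⟪extS S f (x : Xt), g (x : Xt)⟫_ℝ = ⟪f x, resS S g x⟫_ℝ
  rw [extS_apply_coe, resS_apply]

/-- ⟨g, Ω₀λ⟩ = ⟨g↾Ω₀, λ⟩. [cite: Balaban1985BackgroundPropagators, (3.23) p. 394] -/
theorem inner_extS_right (g : PiLp 2 (fun _ : Xt => V)) (f : PiLp 2 (fun _ : ↥S => V)) :
    ⟪g, extS S f⟫_ℝ = ⟪resS S g, f⟫_ℝ := by
  rw [real_inner_comm, inner_extS_left, real_inner_comm]

omit [Fintype Xt] in
/-- Ω₀(f↾Ω₀) = f for f supported in Ω₀. [cite: Balaban1985BackgroundPropagators, (3.23) p. 394] -/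
theorem extS_resS_of_support (μ : PiLp 2 (fun _ : Xt => V)) (h : ∀ z, z ∉ S → μ z = 0) :
    extS S (resS S μ) = μ := by
  refine PiLp.ext fun z => ?_
  by_cases hz : z ∈ S
  · rw [extS_apply, dif_pos hz]
    rfl
  · rw [extS_apply_of_not_mem S _ hz, h z hz]

/-! ## §2  Conjugating an orthogonal projection of L²(Ω₀, 𝔤) by Ω₀: Ω₀ P_W ↾Ω₀ = P_{Ω₀W} -/

section Conj

variable [FiniteDimensional ℝ V]

/-- Equal subspaces have equal orthogonal projections (the projection exists on both sides by whatever instance).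
[folklore] -/
private theorem starProjection_coe_congr {E : Type*} [NormedAddCommGroup E] [InnerProductSpace ℝ E]
    {K K' : Submodule ℝ E} [K.HasOrthogonalProjection] [K'.HasOrthogonalProjection] (h : K = K') :
    (K.starProjection : E →ₗ[ℝ] E) = (K'.starProjection : E →ₗ[ℝ] E) := by
  subst h
  rfl

/-- **Ω₀ ∘ P_W ∘ ↾Ω₀ = P_{Ω₀W}**: for any subspace W ⊂ L²(Ω₀, 𝔤), the orthogonal projection onto W, preceded by
restriction and followed by extension by zero, is the orthogonal projection of L²(T_η, 𝔤) onto Ω₀W (W extended by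
zero).  Proof: Ω₀(P_W(f↾Ω₀)) ∈ Ω₀W and f − Ω₀(P_W(f↾Ω₀)) ⊥ Ω₀w for w ∈ W, because ⟨f − Ω₀(P_W(f↾Ω₀)), Ω₀w⟩ =
⟨f↾Ω₀ − P_W(f↾Ω₀), w⟩ = 0 — the Hilbert-space step behind reading the L²(Ω₀, 𝔤)-projection R of (3.21) on
L²(T_η, 𝔤) through «Ω₀ denotes a characteristic function of Ω₀».
[cite: Balaban1985BackgroundPropagators, (3.21)+(3.23) p. 394] -/
theorem extS_starProjection_resS (W : Submodule ℝ (PiLp 2 (fun _ : ↥S => V))) :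
    extS S ∘ₗ (W.starProjection : PiLp 2 (fun _ : ↥S => V) →ₗ[ℝ] PiLp 2 (fun _ : ↥S => V)) ∘ₗ resS S
      = ((W.map (extS S)).starProjection : PiLp 2 (fun _ : Xt => V) →ₗ[ℝ] PiLp 2 (fun _ : Xt => V)) := by
  refine LinearMap.ext fun f => ?_
  rw [LinearMap.comp_apply, LinearMap.comp_apply, ContinuousLinearMap.coe_coe, ContinuousLinearMap.coe_coe]
  symm
  refine Submodule.eq_starProjection_of_mem_of_inner_eq_zero
    (Submodule.mem_map_of_mem (W.starProjection_apply_mem _)) ?_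
  intro w' hw'
  obtain ⟨w, hw, rfl⟩ := Submodule.mem_map.mp hw'
  rw [inner_extS_right, map_sub, resS_extS]
  exact Submodule.starProjection_inner_eq_zero _ _ hw

variable {F : Type*} [NormedAddCommGroup F] [InnerProductSpace ℝ F]

/-- Under the printed inputs of (3.25) (ANY operator Δ on L²(Ω₀, 𝔤), any Q′): Ω₀ ∘ R ∘ ↾Ω₀ is the orthogonal
projection of L²(T_η, 𝔤) onto Ω₀ℛ, ℛ = ΔN(Q′). [cite: Balaban1985BackgroundPropagators, (3.21)+(3.25) p. 394] -/
theorem extS_R325_resS {Δ : PiLp 2 (fun _ : ↥S => V) →ₗ[ℝ] PiLp 2 (fun _ : ↥S => V)}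
    {q : PiLp 2 (fun _ : ↥S => V) →ₗ[ℝ] F} {qs : F →ₗ[ℝ] PiLp 2 (fun _ : ↥S => V)} {A : F →ₗ[ℝ] F}
    {g : PiLp 2 (fun _ : ↥S => V) →ₗ[ℝ] PiLp 2 (fun _ : ↥S => V)} {c : F →ₗ[ℝ] F} (h : Data Δ q qs A g c) :
    extS S ∘ₗ R325 q qs g c ∘ₗ resS S
      = (((lapKer Δ q).map (extS S)).starProjection : PiLp 2 (fun _ : Xt => V) →ₗ[ℝ] PiLp 2 (fun _ : Xt => V)) := by
  rw [← h.starProjection_eq_R325]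
  exact extS_starProjection_resS S _

end Conj

/-! ## §3  The Dirichlet operator Ω₀Δ_TΩ₀: Ω₀ℛ = Δ_T(Ω₀N(Q′)) and Ω₀R↾Ω₀ = P_{Δ_T(Ω₀N(Q′))} -/

section Dirichlet

variable (ΔT : PiLp 2 (fun _ : Xt => V) →ₗ[ℝ] PiLp 2 (fun _ : Xt => V))

omit [Fintype Xt] in
/-- Ω₀((Ω₀Δ_TΩ₀)λ) = Δ_T(Ω₀λ) whenever Δ_T(Ω₀λ) is supported in Ω₀.
[cite: Balaban1985BackgroundPropagators, (3.23) p. 394] -/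
theorem extS_dirichlet_apply (l : PiLp 2 (fun _ : ↥S => V)) (hl : ∀ z, z ∉ S → ΔT (extS S l) z = 0) :
    extS S ((resS S ∘ₗ ΔT ∘ₗ extS S) l) = ΔT (extS S l) := by
  rw [LinearMap.comp_apply, LinearMap.comp_apply, extS_resS_of_support S _ hl]

variable {F : Type*} [NormedAddCommGroup F] [InnerProductSpace ℝ F] (q : PiLp 2 (fun _ : ↥S => V) →ₗ[ℝ] F)

omit [Fintype Xt] in
/-- **Ω₀ℛ = Δ_T(Ω₀N(Q′))**: the range ℛ = (Ω₀Δ_TΩ₀)N(Q′) of (3.21), extended by zero to T_η, is Δ_T applied to the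
functions of N(Q′) extended by zero — provided Δ_T(Ω₀λ) stays inside Ω₀ for λ ∈ N(Q′) («the functions λ … vanish on
Ω₁^c», Ω₀ ⊇ Ω₁ plus a layer: §5). [cite: Balaban1985BackgroundPropagators, (3.21)+(3.23) p. 394] -/
theorem map_extS_lapKer_dirichlet (hloc : ∀ l : PiLp 2 (fun _ : ↥S => V), q l = 0 → ∀ z, z ∉ S → ΔT (extS S l) z = 0) :
    (lapKer (resS S ∘ₗ ΔT ∘ₗ extS S) q).map (extS S) = ((LinearMap.ker q).map (extS S)).map ΔT := by
  apply le_antisymm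
  · rintro _ ⟨ω, hω, rfl⟩
    obtain ⟨l, hl, rfl⟩ := (mem_lapKer _ _ ω).1 hω
    rw [extS_dirichlet_apply S ΔT l (hloc l hl)]
    exact Submodule.mem_map_of_mem (Submodule.mem_map_of_mem (LinearMap.mem_ker.2 hl))
  · rintro _ ⟨_, ⟨l, hl, rfl⟩, rfl⟩
    have hl' : q l = 0 := LinearMap.mem_ker.1 hl
    rw [← extS_dirichlet_apply S ΔT l (hloc l hl')]
    exact Submodule.mem_map_of_mem ((mem_lapKer _ _ _).2 ⟨l, hl', rfl⟩)

variable [FiniteDimensional ℝ V]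

/-- **Ω₀ ∘ R ∘ ↾Ω₀ = P_{Δ_T(Ω₀N(Q′))}** ((3.21) as stated, R = THE orthogonal projection onto ℛ): the projection built
in L²(Ω₀, 𝔤) from the Dirichlet operator Ω₀Δ_TΩ₀, read on L²(T_η, 𝔤), is the orthogonal projection onto
Δ_T(Ω₀N(Q′)) — an operator «with some boundary conditions outside Ω₁» in which Ω₀ enters only through Ω₀N(Q′).
[cite: Balaban1985BackgroundPropagators, (3.21)+(3.23) p. 394] -/
theorem extS_starProjection_resS_dirichlet
    (hloc : ∀ l : PiLp 2 (fun _ : ↥S => V), q l = 0 → ∀ z, z ∉ S → ΔT (extS S l) z = 0) :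
    extS S ∘ₗ ((lapKer (resS S ∘ₗ ΔT ∘ₗ extS S) q).starProjection :
        PiLp 2 (fun _ : ↥S => V) →ₗ[ℝ] PiLp 2 (fun _ : ↥S => V)) ∘ₗ resS S
      = ((((LinearMap.ker q).map (extS S)).map ΔT).starProjection :
        PiLp 2 (fun _ : Xt => V) →ₗ[ℝ] PiLp 2 (fun _ : Xt => V)) := by
  rw [extS_starProjection_resS]
  exact starProjection_coe_congr (map_extS_lapKer_dirichlet S ΔT q hloc)

/-- The same for the (3.25) operator under the printed inputs over the Dirichlet operator Ω₀Δ_TΩ₀: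
Ω₀ ∘ R ∘ ↾Ω₀ = P_{Δ_T(Ω₀N(Q′))}. [cite: Balaban1985BackgroundPropagators, (3.21)+(3.25) p. 394] -/
theorem extS_R325_resS_dirichlet {qs : F →ₗ[ℝ] PiLp 2 (fun _ : ↥S => V)} {A : F →ₗ[ℝ] F}
    {g : PiLp 2 (fun _ : ↥S => V) →ₗ[ℝ] PiLp 2 (fun _ : ↥S => V)} {c : F →ₗ[ℝ] F}
    (h : Data (resS S ∘ₗ ΔT ∘ₗ extS S) q qs A g c)
    (hloc : ∀ l : PiLp 2 (fun _ : ↥S => V), q l = 0 → ∀ z, z ∉ S → ΔT (extS S l) z = 0) :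
    extS S ∘ₗ R325 q qs g c ∘ₗ resS S
      = ((((LinearMap.ker q).map (extS S)).map ΔT).starProjection :
        PiLp 2 (fun _ : Xt => V) →ₗ[ℝ] PiLp 2 (fun _ : Xt => V)) := by
  rw [← h.starProjection_eq_R325]
  exact extS_starProjection_resS_dirichlet S ΔT q hloc

end Dirichlet

/-! ## §4  Independence of the auxiliary domain Ω₀ -/

section Indep

variable (ΔT : PiLp 2 (fun _ : Xt => V) →ₗ[ℝ] PiLp 2 (fun _ : Xt => V)) (S₁ S₂ : Finset Xt)
  {F₁ F₂ : Type*} [NormedAddCommGroup F₁] [InnerProductSpace ℝ F₁] [NormedAddCommGroup F₂] [InnerProductSpace ℝ F₂]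
  (q₁ : PiLp 2 (fun _ : ↥S₁ => V) →ₗ[ℝ] F₁) (q₂ : PiLp 2 (fun _ : ↥S₂ => V) →ₗ[ℝ] F₂)

omit [Fintype Xt] in
/-- **Ω₀N(Q′) = N_T**: if Q′λ = 0 exactly when a fixed family of T_η-constraints Q_T vanishes on Ω₀λ, and every
solution of Q_T μ = 0 is supported in Ω₀ («the functions λ … vanish on Ω₁^c», Ω₁ ⊂ Ω₀), then N(Q′) extended by zero
is N(Q_T) — a space that does not mention Ω₀. [cite: Balaban1985BackgroundPropagators, (3.18) p. 393, (3.21) p. 394] -/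
theorem map_extS_ker_eq {F' : Type*} [AddCommGroup F'] [Module ℝ F'] (QT : PiLp 2 (fun _ : Xt => V) →ₗ[ℝ] F')
    {F : Type*} [AddCommGroup F] [Module ℝ F] (q : PiLp 2 (fun _ : ↥S => V) →ₗ[ℝ] F)
    (hker : ∀ l, q l = 0 ↔ QT (extS S l) = 0) (hsupp : ∀ μ, QT μ = 0 → ∀ z, z ∉ S → μ z = 0) :
    (LinearMap.ker q).map (extS S) = LinearMap.ker QT := by
  apply le_antisymm
  · rintro _ ⟨l, hl, rfl⟩
    exact LinearMap.mem_ker.2 ((hker l).1 (LinearMap.mem_ker.1 hl))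
  · intro μ hμ
    have hμ' : QT μ = 0 := LinearMap.mem_ker.1 hμ
    refine ⟨resS S μ, LinearMap.mem_ker.2 ((hker _).2 ?_), extS_resS_of_support S μ (hsupp μ hμ')⟩
    rwa [extS_resS_of_support S μ (hsupp μ hμ')]

variable [FiniteDimensional ℝ V]

/-- **R DOES NOT DEPEND ON Ω₀** ((3.21) form): for two admissible domains Ω₀, Ω₀′ — Δ_T maps Ω₀N(Q′), resp. Ω₀′N(Q′′),
into functions supported in Ω₀, resp. Ω₀′, and the two spaces N(Q′), N(Q′′) coincide once extended by zero to T_η —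
the projections R, R′ built from the Dirichlet operators Ω₀Δ_TΩ₀, Ω₀′Δ_TΩ₀′ give ONE operator on L²(T_η, 𝔤):
Ω₀R↾Ω₀ = Ω₀′R′↾Ω₀′ («we do not indicate this fact in our notations»).
[cite: Balaban1985BackgroundPropagators, (3.21)+(3.23) p. 394] -/
theorem starProjection_dirichlet_indep
    (hloc₁ : ∀ l : PiLp 2 (fun _ : ↥S₁ => V), q₁ l = 0 → ∀ z, z ∉ S₁ → ΔT (extS S₁ l) z = 0)
    (hloc₂ : ∀ l : PiLp 2 (fun _ : ↥S₂ => V), q₂ l = 0 → ∀ z, z ∉ S₂ → ΔT (extS S₂ l) z = 0)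
    (hN : (LinearMap.ker q₁).map (extS S₁) = (LinearMap.ker q₂).map (extS S₂)) :
    extS S₁ ∘ₗ ((lapKer (resS S₁ ∘ₗ ΔT ∘ₗ extS S₁) q₁).starProjection :
        PiLp 2 (fun _ : ↥S₁ => V) →ₗ[ℝ] PiLp 2 (fun _ : ↥S₁ => V)) ∘ₗ resS S₁
      = extS S₂ ∘ₗ ((lapKer (resS S₂ ∘ₗ ΔT ∘ₗ extS S₂) q₂).starProjection :
        PiLp 2 (fun _ : ↥S₂ => V) →ₗ[ℝ] PiLp 2 (fun _ : ↥S₂ => V)) ∘ₗ resS S₂ := by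
  rw [extS_starProjection_resS_dirichlet S₁ ΔT q₁ hloc₁, extS_starProjection_resS_dirichlet S₂ ΔT q₂ hloc₂]
  exact starProjection_coe_congr (by rw [hN])

/-- **R DOES NOT DEPEND ON Ω₀** ((3.25) form): the same for the (3.25) operators under the printed inputs over the two
Dirichlet operators. [cite: Balaban1985BackgroundPropagators, (3.21)+(3.25) p. 394] -/
theorem R325_dirichlet_indep {qs₁ : F₁ →ₗ[ℝ] PiLp 2 (fun _ : ↥S₁ => V)} {A₁ : F₁ →ₗ[ℝ] F₁}
    {g₁ : PiLp 2 (fun _ : ↥S₁ => V) →ₗ[ℝ] PiLp 2 (fun _ : ↥S₁ => V)} {c₁ : F₁ →ₗ[ℝ] F₁}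
    {qs₂ : F₂ →ₗ[ℝ] PiLp 2 (fun _ : ↥S₂ => V)} {A₂ : F₂ →ₗ[ℝ] F₂}
    {g₂ : PiLp 2 (fun _ : ↥S₂ => V) →ₗ[ℝ] PiLp 2 (fun _ : ↥S₂ => V)} {c₂ : F₂ →ₗ[ℝ] F₂}
    (h₁ : Data (resS S₁ ∘ₗ ΔT ∘ₗ extS S₁) q₁ qs₁ A₁ g₁ c₁) (h₂ : Data (resS S₂ ∘ₗ ΔT ∘ₗ extS S₂) q₂ qs₂ A₂ g₂ c₂)
    (hloc₁ : ∀ l : PiLp 2 (fun _ : ↥S₁ => V), q₁ l = 0 → ∀ z, z ∉ S₁ → ΔT (extS S₁ l) z = 0)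
    (hloc₂ : ∀ l : PiLp 2 (fun _ : ↥S₂ => V), q₂ l = 0 → ∀ z, z ∉ S₂ → ΔT (extS S₂ l) z = 0)
    (hN : (LinearMap.ker q₁).map (extS S₁) = (LinearMap.ker q₂).map (extS S₂)) :
    extS S₁ ∘ₗ R325 q₁ qs₁ g₁ c₁ ∘ₗ resS S₁ = extS S₂ ∘ₗ R325 q₂ qs₂ g₂ c₂ ∘ₗ resS S₂ := by
  rw [extS_R325_resS_dirichlet S₁ ΔT q₁ h₁ hloc₁, extS_R325_resS_dirichlet S₂ ΔT q₂ h₂ hloc₂]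
  exact starProjection_coe_congr (by rw [hN])

/-- The Ω₀-independence with the coincidence hypothesis in its printed form: both N(Q′), N(Q′′) are cut out by the
same T_η-constraints Q_T, whose solutions live inside Ω₀ ∩ Ω₀′.
[cite: Balaban1985BackgroundPropagators, (3.18) p. 393, (3.21)+(3.25) p. 394] -/
theorem R325_dirichlet_indep_of_constraints {F' : Type*} [AddCommGroup F'] [Module ℝ F']
    (QT : PiLp 2 (fun _ : Xt => V) →ₗ[ℝ] F')
    (hsupp₁ : ∀ μ, QT μ = 0 → ∀ z, z ∉ S₁ → μ z = 0) (hsupp₂ : ∀ μ, QT μ = 0 → ∀ z, z ∉ S₂ → μ z = 0)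
    (hker₁ : ∀ l, q₁ l = 0 ↔ QT (extS S₁ l) = 0) (hker₂ : ∀ l, q₂ l = 0 ↔ QT (extS S₂ l) = 0)
    {qs₁ : F₁ →ₗ[ℝ] PiLp 2 (fun _ : ↥S₁ => V)} {A₁ : F₁ →ₗ[ℝ] F₁}
    {g₁ : PiLp 2 (fun _ : ↥S₁ => V) →ₗ[ℝ] PiLp 2 (fun _ : ↥S₁ => V)} {c₁ : F₁ →ₗ[ℝ] F₁}
    {qs₂ : F₂ →ₗ[ℝ] PiLp 2 (fun _ : ↥S₂ => V)} {A₂ : F₂ →ₗ[ℝ] F₂}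
    {g₂ : PiLp 2 (fun _ : ↥S₂ => V) →ₗ[ℝ] PiLp 2 (fun _ : ↥S₂ => V)} {c₂ : F₂ →ₗ[ℝ] F₂}
    (h₁ : Data (resS S₁ ∘ₗ ΔT ∘ₗ extS S₁) q₁ qs₁ A₁ g₁ c₁) (h₂ : Data (resS S₂ ∘ₗ ΔT ∘ₗ extS S₂) q₂ qs₂ A₂ g₂ c₂)
    (hloc₁ : ∀ l : PiLp 2 (fun _ : ↥S₁ => V), q₁ l = 0 → ∀ z, z ∉ S₁ → ΔT (extS S₁ l) z = 0)
    (hloc₂ : ∀ l : PiLp 2 (fun _ : ↥S₂ => V), q₂ l = 0 → ∀ z, z ∉ S₂ → ΔT (extS S₂ l) z = 0) :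
    extS S₁ ∘ₗ R325 q₁ qs₁ g₁ c₁ ∘ₗ resS S₁ = extS S₂ ∘ₗ R325 q₂ qs₂ g₂ c₂ ∘ₗ resS S₂ :=
  R325_dirichlet_indep ΔT S₁ S₂ q₁ q₂ h₁ h₂ hloc₁ hloc₂
    ((map_extS_ker_eq S₁ QT q₁ hker₁ hsupp₁).trans (map_extS_ker_eq S₂ QT q₂ hker₂ hsupp₂).symm)

end Indep

/-! ## §5  The hypotheses on the cell's lattice carriers (Δ_T = `lapL`, Q′ = `qL`) -/

section Lattice

variable [FiniteDimensional ℝ V] (τ : Xt → Xt → V →ₗ[ℝ] V) (bonds : Finset (Xt × Xt)) (cb : Xt × Xt → ℝ)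

/-- **Δ_T(Ω₀λ) = 0 off Ω₀** when λ vanishes on Ω₀ ∖ Ω₁ and no bond of T_η joins Ω₁ to T_η ∖ Ω₀ («we may add to Ω₁ a
thinner layer of the big blocks surrounding Ω₁»): the hypothesis `hloc` of §§3–4 for the covariant Laplacian
Δ^η_U = D\*D of (3.23) (a site value of D\*Df involves only f at the site and at its bonded neighbours,
`B8Eq194CriterionCurved.lapL_apply_eq_zero`). [cite: Balaban1985BackgroundPropagators, (3.23) p. 394] -/
theorem lapL_extS_apply_eq_zero_of_layer (hcb : ∀ b ∈ bonds, 0 ≤ cb b) (Ω₁ : Finset Xt)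
    (hlayer : ∀ b ∈ bonds, (b.1 ∈ Ω₁ → b.2 ∈ S) ∧ (b.2 ∈ Ω₁ → b.1 ∈ S))
    (l : PiLp 2 (fun _ : ↥S => V)) (hl : ∀ x : ↥S, (x : Xt) ∉ Ω₁ → l x = 0) (z : Xt) (hz : z ∉ S) :
    lapL τ bonds cb (extS S l) z = 0 := by
  refine lapL_apply_eq_zero τ bonds cb hcb _ z (extS_apply_of_not_mem S _ hz) fun z' hz' => ?_
  by_cases hz'S : z' ∈ S
  · have hz'Ω : z' ∉ Ω₁ := fun hΩ₁ => by
      rcases hz' with hb | hb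
      · exact hz ((hlayer _ hb).2 hΩ₁)
      · exact hz ((hlayer _ hb).1 hΩ₁)
    rw [extS_apply, dif_pos hz'S]
    exact hl ⟨z', hz'S⟩ hz'Ω
  · exact extS_apply_of_not_mem S _ hz'S

omit [Fintype Xt] [DecidableEq Xt] [FiniteDimensional ℝ V] in
/-- **A 0-block forces λ = 0 at its site**: if the block of c is the single site x = y(c) (empty contour) with weight
w(c, x) ≠ 0, then (Q′λ)(c) = w(c, x)λ(x), so Q′λ = 0 at c gives λ(x) = 0 — «(Q′λ)(y) = (Q′_j(U)λ)(y) for y ∈ Λ_j^{(j)}»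
with j = 0 on Λ₀ = Ω₀ ∖ Ω₁: «the functions λ in (3.22) vanish on Ω₁^c».
[cite: Balaban1985BackgroundPropagators, (3.18) p. 393, p. 394] -/
theorem apply_eq_zero_of_qL_singleton {X Y : Type*} (τ : X → X → V →ₗ[ℝ] V) (w : Y → X → ℝ) (B : Y → Finset X)
    (Γ : Y → X → List X) (y : Y → X) (f : PiLp 2 (fun _ : X => V)) {c : Y} {x : X}
    (hB : B c = {x}) (hy : y c = x) (hΓ : Γ c x = []) (hw : w c x ≠ 0) (hq : qL τ w B Γ y f c = 0) : f x = 0 := by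
  rw [qL_apply, avgQ, hB, Finset.sum_singleton, hy, hΓ, pathTr_singleton, LinearMap.id_apply] at hq
  exact (smul_eq_zero.mp hq).resolve_left hw

omit [Fintype Xt] [DecidableEq Xt] [FiniteDimensional ℝ V] in
/-- The solutions of the T_η-constraints Q_Tμ = 0 vanish off Ω₁ when every site off Ω₁ is a 0-block of Q_T.
[cite: Balaban1985BackgroundPropagators, (3.18) p. 393, p. 394] -/
theorem apply_eq_zero_of_qL_singletons {YT : Type*} (wT : YT → Xt → ℝ) (BT : YT → Finset Xt)
    (ΓT : YT → Xt → List Xt) (yT : YT → Xt) (Ω₁ : Finset Xt)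
    (hsing : ∀ x, x ∉ Ω₁ → ∃ cT, BT cT = {x} ∧ yT cT = x ∧ ΓT cT x = [] ∧ wT cT x ≠ 0)
    (μ : PiLp 2 (fun _ : Xt => V)) (hμ : qL τ wT BT ΓT yT μ = 0) (z : Xt) (hz : z ∉ Ω₁) : μ z = 0 := by
  obtain ⟨cT, hB, hy, hΓ, hw⟩ := hsing z hz
  exact apply_eq_zero_of_qL_singleton τ wT BT ΓT yT μ hB hy hΓ hw (by rw [hμ]; rfl)

/-- `hloc` of §§3–4 on the lattice: if Q′λ = 0 forces the T_η-constraints on Ω₀λ, every site off Ω₁ is a 0-block of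
them, and no bond joins Ω₁ to T_η ∖ Ω₀, then Δ_T(Ω₀λ) = 0 off Ω₀ for λ ∈ N(Q′).
[cite: Balaban1985BackgroundPropagators, (3.18) p. 393, (3.23) p. 394] -/
theorem lapL_extS_apply_eq_zero_of_constraints (hcb : ∀ b ∈ bonds, 0 ≤ cb b) (Ω₁ : Finset Xt) {YT : Type*}
    (wT : YT → Xt → ℝ) (BT : YT → Finset Xt) (ΓT : YT → Xt → List Xt) (yT : YT → Xt)
    (hsing : ∀ x, x ∉ Ω₁ → ∃ cT, BT cT = {x} ∧ yT cT = x ∧ ΓT cT x = [] ∧ wT cT x ≠ 0)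
    (hlayer : ∀ b ∈ bonds, (b.1 ∈ Ω₁ → b.2 ∈ S) ∧ (b.2 ∈ Ω₁ → b.1 ∈ S))
    {F : Type*} [AddCommGroup F] [Module ℝ F] (q : PiLp 2 (fun _ : ↥S => V) →ₗ[ℝ] F)
    (hker : ∀ l, q l = 0 ↔ qL τ wT BT ΓT yT (extS S l) = 0)
    (l : PiLp 2 (fun _ : ↥S => V)) (hl : q l = 0) (z : Xt) (hz : z ∉ S) : lapL τ bonds cb (extS S l) z = 0 :=
  lapL_extS_apply_eq_zero_of_layer S τ bonds cb hcb Ω₁ hlayer l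
    (fun x hx => by
      have h := apply_eq_zero_of_qL_singletons τ wT BT ΓT yT Ω₁ hsing (extS S l) ((hker l).1 hl) x hx
      rwa [extS_apply_coe] at h) z hz

omit [Fintype Xt] [DecidableEq Xt] [FiniteDimensional ℝ V] in
/-- Parallel transport along a contour inside Ω₀ is the same map whether read on Ω₀ or on T_η. [folklore] -/
private theorem pathTr_resT : ∀ L : List ↥S, pathTr (resT S τ) L = pathTr τ (L.map Subtype.val)
  | [] => rfl
  | [_] => rfl
  | x :: x' :: rest => by
    rw [List.map_cons, List.map_cons, pathTr_cons_cons, pathTr_cons_cons, ← List.map_cons, ← pathTr_resT (x' :: rest)]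
    rfl

omit [Fintype Xt] [FiniteDimensional ℝ V] in
/-- **(Q_T(Ω₀λ))(c) = (Q′λ)(c) on the blocks of Ω₀**: when the Ω₀-block of c, its weights, contours and centre are the
T_η-block data of ι(c) read inside Ω₀ («Ω₀ is a union of big blocks»), the T_η-average of Ω₀λ over that block is the
Ω₀-average of λ. [cite: Balaban1985BackgroundPropagators, (3.18)-(3.19) p. 393] -/
theorem qL_extS_apply_of_compat {Y YT : Type*} (wT : YT → Xt → ℝ) (BT : YT → Finset Xt) (ΓT : YT → Xt → List Xt)
    (yT : YT → Xt) (w : Y → ↥S → ℝ) (B : Y → Finset ↥S) (Γ : Y → ↥S → List ↥S) (y : Y → ↥S) (ι : Y → YT)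
    (hB : ∀ c, BT (ι c) = (B c).map (Function.Embedding.subtype (· ∈ S)))
    (hw : ∀ c (x : ↥S), wT (ι c) x = w c x) (hΓ : ∀ c (x : ↥S), ΓT (ι c) x = (Γ c x).map Subtype.val)
    (hy : ∀ c, yT (ι c) = y c) (l : PiLp 2 (fun _ : ↥S => V)) (c : Y) :
    qL τ wT BT ΓT yT (extS S l) (ι c) = qL (resT S τ) w B Γ y l c := by
  rw [qL_apply, qL_apply, avgQ, avgQ, hB, Finset.sum_map]
  refine Finset.sum_congr rfl fun x _ => ?_
  rw [Function.Embedding.coe_subtype, hw, hy, hΓ, ← List.map_cons, ← pathTr_resT, extS_apply_coe]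

omit [Fintype Xt] [FiniteDimensional ℝ V] in
/-- **(Q_T(Ω₀λ))(c) = 0 on the 0-blocks off Ω₀**: a T_η-block consisting of a single site outside Ω₀ averages Ω₀λ = 0
there. [cite: Balaban1985BackgroundPropagators, (3.18)-(3.19) p. 393, p. 394] -/
theorem qL_extS_apply_of_offRange {YT : Type*} (wT : YT → Xt → ℝ) (BT : YT → Finset Xt) (ΓT : YT → Xt → List Xt)
    (yT : YT → Xt) (cT : YT) {x : Xt} (hx : x ∉ S) (hB : BT cT = {x}) (hy : yT cT = x) (hΓ : ΓT cT x = [])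
    (l : PiLp 2 (fun _ : ↥S => V)) : qL τ wT BT ΓT yT (extS S l) cT = 0 := by
  rw [qL_apply, avgQ, hB, Finset.sum_singleton, hy, hΓ, pathTr_singleton, LinearMap.id_apply,
    extS_apply_of_not_mem S l hx, smul_zero]

omit [Fintype Xt] [FiniteDimensional ℝ V] in
/-- **Q′λ = 0 ⟺ Q_T(Ω₀λ) = 0** — the hypothesis `hker` of §4 on the lattice: the blocks of Q′ on Ω₀ are the
T_η-blocks inside Ω₀ (through ι), and every other T_η-block is a single site off Ω₀.
[cite: Balaban1985BackgroundPropagators, (3.18)-(3.19) p. 393, p. 394] -/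
theorem qL_ker_iff_of_compat {Y YT : Type*} (wT : YT → Xt → ℝ) (BT : YT → Finset Xt) (ΓT : YT → Xt → List Xt)
    (yT : YT → Xt) (w : Y → ↥S → ℝ) (B : Y → Finset ↥S) (Γ : Y → ↥S → List ↥S) (y : Y → ↥S) (ι : Y → YT)
    (hB : ∀ c, BT (ι c) = (B c).map (Function.Embedding.subtype (· ∈ S)))
    (hw : ∀ c (x : ↥S), wT (ι c) x = w c x) (hΓ : ∀ c (x : ↥S), ΓT (ι c) x = (Γ c x).map Subtype.val)
    (hy : ∀ c, yT (ι c) = y c)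
    (hoff : ∀ cT, cT ∉ Set.range ι → ∃ x, x ∉ S ∧ BT cT = {x} ∧ yT cT = x ∧ ΓT cT x = [])
    (l : PiLp 2 (fun _ : ↥S => V)) :
    qL (resT S τ) w B Γ y l = 0 ↔ qL τ wT BT ΓT yT (extS S l) = 0 := by
  constructor
  · intro h
    refine PiLp.ext fun cT => ?_
    by_cases hc : cT ∈ Set.range ι
    · obtain ⟨c, rfl⟩ := hc
      rw [qL_extS_apply_of_compat S τ wT BT ΓT yT w B Γ y ι hB hw hΓ hy l c, h]
      rfl
    · obtain ⟨x, hx, hBx, hyx, hΓx⟩ := hoff cT hc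
      rw [qL_extS_apply_of_offRange S τ wT BT ΓT yT cT hx hBx hyx hΓx l]
      rfl
  · intro h
    refine PiLp.ext fun c => ?_
    rw [← qL_extS_apply_of_compat S τ wT BT ΓT yT w B Γ y ι hB hw hΓ hy l c, h]
    rfl

/-- **R DOES NOT DEPEND ON Ω₀ — on the lattice.**  T_η with its covariant Laplacian Δ_T = D\*D ((3.23), bond weights
c_b ≥ 0); the T_η-constraints Q_T (block averages (3.19) over the blocks of Ω₁ and the single sites off Ω₁); two
domains Ω₀ = S₁, Ω₀′ = S₂ containing Ω₁ together with every site bonded to Ω₁ (a surrounding layer); on each, an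
averaging Q′ whose null space is cut out by Q_T, and the printed inputs of (3.25) over the Dirichlet operator Ω₀Δ_TΩ₀
(existence = Theorem 3.11, a hypothesis here).  Then Ω₀R↾Ω₀ = Ω₀′R′↾Ω₀′ as operators on L²(T_η, 𝔤).
[cite: Balaban1985BackgroundPropagators, (3.18) p. 393, (3.21)+(3.23)+(3.25) p. 394] -/
theorem R325_dirichlet_indep_lattice (hcb : ∀ b ∈ bonds, 0 ≤ cb b) (Ω₁ : Finset Xt) {YT : Type*}
    (wT : YT → Xt → ℝ) (BT : YT → Finset Xt) (ΓT : YT → Xt → List Xt) (yT : YT → Xt)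
    (hsing : ∀ x, x ∉ Ω₁ → ∃ cT, BT cT = {x} ∧ yT cT = x ∧ ΓT cT x = [] ∧ wT cT x ≠ 0)
    (S₁ S₂ : Finset Xt) (hΩ₁ : Ω₁ ⊆ S₁) (hΩ₂ : Ω₁ ⊆ S₂)
    (hlayer₁ : ∀ b ∈ bonds, (b.1 ∈ Ω₁ → b.2 ∈ S₁) ∧ (b.2 ∈ Ω₁ → b.1 ∈ S₁))
    (hlayer₂ : ∀ b ∈ bonds, (b.1 ∈ Ω₁ → b.2 ∈ S₂) ∧ (b.2 ∈ Ω₁ → b.1 ∈ S₂))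
    {F₁ F₂ : Type*} [NormedAddCommGroup F₁] [InnerProductSpace ℝ F₁] [NormedAddCommGroup F₂]
    [InnerProductSpace ℝ F₂] (q₁ : PiLp 2 (fun _ : ↥S₁ => V) →ₗ[ℝ] F₁) (q₂ : PiLp 2 (fun _ : ↥S₂ => V) →ₗ[ℝ] F₂)
    (hker₁ : ∀ l, q₁ l = 0 ↔ qL τ wT BT ΓT yT (extS S₁ l) = 0)
    (hker₂ : ∀ l, q₂ l = 0 ↔ qL τ wT BT ΓT yT (extS S₂ l) = 0)
    {qs₁ : F₁ →ₗ[ℝ] PiLp 2 (fun _ : ↥S₁ => V)} {A₁ : F₁ →ₗ[ℝ] F₁}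
    {g₁ : PiLp 2 (fun _ : ↥S₁ => V) →ₗ[ℝ] PiLp 2 (fun _ : ↥S₁ => V)} {c₁ : F₁ →ₗ[ℝ] F₁}
    {qs₂ : F₂ →ₗ[ℝ] PiLp 2 (fun _ : ↥S₂ => V)} {A₂ : F₂ →ₗ[ℝ] F₂}
    {g₂ : PiLp 2 (fun _ : ↥S₂ => V) →ₗ[ℝ] PiLp 2 (fun _ : ↥S₂ => V)} {c₂ : F₂ →ₗ[ℝ] F₂}
    (h₁ : Data (resS S₁ ∘ₗ lapL τ bonds cb ∘ₗ extS S₁) q₁ qs₁ A₁ g₁ c₁)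
    (h₂ : Data (resS S₂ ∘ₗ lapL τ bonds cb ∘ₗ extS S₂) q₂ qs₂ A₂ g₂ c₂) :
    extS S₁ ∘ₗ R325 q₁ qs₁ g₁ c₁ ∘ₗ resS S₁ = extS S₂ ∘ₗ R325 q₂ qs₂ g₂ c₂ ∘ₗ resS S₂ :=
  R325_dirichlet_indep_of_constraints (lapL τ bonds cb) S₁ S₂ q₁ q₂ (qL τ wT BT ΓT yT)
    (fun μ hμ z hz => apply_eq_zero_of_qL_singletons τ wT BT ΓT yT Ω₁ hsing μ hμ z fun hzΩ => hz (hΩ₁ hzΩ))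
    (fun μ hμ z hz => apply_eq_zero_of_qL_singletons τ wT BT ΓT yT Ω₁ hsing μ hμ z fun hzΩ => hz (hΩ₂ hzΩ))
    hker₁ hker₂ h₁ h₂
    (lapL_extS_apply_eq_zero_of_constraints S₁ τ bonds cb hcb Ω₁ wT BT ΓT yT hsing hlayer₁ q₁ hker₁)
    (lapL_extS_apply_eq_zero_of_constraints S₂ τ bonds cb hcb Ω₁ wT BT ΓT yT hsing hlayer₂ q₂ hker₂)

/-- **R DOES NOT DEPEND ON Ω₀ — with the Ω₀-averagings spelled out.**  As `R325_dirichlet_indep_lattice`, the two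
averagings being the cell's `qL` on the carriers Ω₀ = S₁, Ω₀′ = S₂ (Q′\* = the adjoint), with blocks, weights,
contours and centres those of the T_η-blocks inside the domain (through ι₁, ι₂) and every remaining T_η-block a single
site off the domain. [cite: Balaban1985BackgroundPropagators, (3.18)-(3.19) p. 393, (3.21)+(3.23)+(3.25) p. 394] -/
theorem R325_dirichlet_indep_blocks (hcb : ∀ b ∈ bonds, 0 ≤ cb b) (Ω₁ : Finset Xt) {YT : Type*}
    (wT : YT → Xt → ℝ) (BT : YT → Finset Xt) (ΓT : YT → Xt → List Xt) (yT : YT → Xt)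
    (hsing : ∀ x, x ∉ Ω₁ → ∃ cT, BT cT = {x} ∧ yT cT = x ∧ ΓT cT x = [] ∧ wT cT x ≠ 0)
    (S₁ S₂ : Finset Xt) (hΩ₁ : Ω₁ ⊆ S₁) (hΩ₂ : Ω₁ ⊆ S₂)
    (hlayer₁ : ∀ b ∈ bonds, (b.1 ∈ Ω₁ → b.2 ∈ S₁) ∧ (b.2 ∈ Ω₁ → b.1 ∈ S₁))
    (hlayer₂ : ∀ b ∈ bonds, (b.1 ∈ Ω₁ → b.2 ∈ S₂) ∧ (b.2 ∈ Ω₁ → b.1 ∈ S₂))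
    {Y₁ Y₂ : Type*} [Fintype Y₁] [Fintype Y₂]
    (w₁ : Y₁ → ↥S₁ → ℝ) (B₁ : Y₁ → Finset ↥S₁) (Γ₁ : Y₁ → ↥S₁ → List ↥S₁) (y₁ : Y₁ → ↥S₁) (ι₁ : Y₁ → YT)
    (hB₁ : ∀ c, BT (ι₁ c) = (B₁ c).map (Function.Embedding.subtype (· ∈ S₁)))
    (hw₁ : ∀ c (x : ↥S₁), wT (ι₁ c) x = w₁ c x) (hΓ₁ : ∀ c (x : ↥S₁), ΓT (ι₁ c) x = (Γ₁ c x).map Subtype.val)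
    (hy₁ : ∀ c, yT (ι₁ c) = y₁ c)
    (hoff₁ : ∀ cT, cT ∉ Set.range ι₁ → ∃ x, x ∉ S₁ ∧ BT cT = {x} ∧ yT cT = x ∧ ΓT cT x = [])
    (w₂ : Y₂ → ↥S₂ → ℝ) (B₂ : Y₂ → Finset ↥S₂) (Γ₂ : Y₂ → ↥S₂ → List ↥S₂) (y₂ : Y₂ → ↥S₂) (ι₂ : Y₂ → YT)
    (hB₂ : ∀ c, BT (ι₂ c) = (B₂ c).map (Function.Embedding.subtype (· ∈ S₂)))
    (hw₂ : ∀ c (x : ↥S₂), wT (ι₂ c) x = w₂ c x) (hΓ₂ : ∀ c (x : ↥S₂), ΓT (ι₂ c) x = (Γ₂ c x).map Subtype.val)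
    (hy₂ : ∀ c, yT (ι₂ c) = y₂ c)
    (hoff₂ : ∀ cT, cT ∉ Set.range ι₂ → ∃ x, x ∉ S₂ ∧ BT cT = {x} ∧ yT cT = x ∧ ΓT cT x = [])
    {A₁ : PiLp 2 (fun _ : Y₁ => V) →ₗ[ℝ] PiLp 2 (fun _ : Y₁ => V)}
    {g₁ : PiLp 2 (fun _ : ↥S₁ => V) →ₗ[ℝ] PiLp 2 (fun _ : ↥S₁ => V)}
    {c₁ : PiLp 2 (fun _ : Y₁ => V) →ₗ[ℝ] PiLp 2 (fun _ : Y₁ => V)}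
    {A₂ : PiLp 2 (fun _ : Y₂ => V) →ₗ[ℝ] PiLp 2 (fun _ : Y₂ => V)}
    {g₂ : PiLp 2 (fun _ : ↥S₂ => V) →ₗ[ℝ] PiLp 2 (fun _ : ↥S₂ => V)}
    {c₂ : PiLp 2 (fun _ : Y₂ => V) →ₗ[ℝ] PiLp 2 (fun _ : Y₂ => V)}
    (h₁ : Data (resS S₁ ∘ₗ lapL τ bonds cb ∘ₗ extS S₁) (qL (resT S₁ τ) w₁ B₁ Γ₁ y₁)
      (LinearMap.adjoint (qL (resT S₁ τ) w₁ B₁ Γ₁ y₁)) A₁ g₁ c₁)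
    (h₂ : Data (resS S₂ ∘ₗ lapL τ bonds cb ∘ₗ extS S₂) (qL (resT S₂ τ) w₂ B₂ Γ₂ y₂)
      (LinearMap.adjoint (qL (resT S₂ τ) w₂ B₂ Γ₂ y₂)) A₂ g₂ c₂) :
    extS S₁ ∘ₗ R325 (qL (resT S₁ τ) w₁ B₁ Γ₁ y₁) (LinearMap.adjoint (qL (resT S₁ τ) w₁ B₁ Γ₁ y₁)) g₁ c₁ ∘ₗ resS S₁
      = extS S₂ ∘ₗ R325 (qL (resT S₂ τ) w₂ B₂ Γ₂ y₂) (LinearMap.adjoint (qL (resT S₂ τ) w₂ B₂ Γ₂ y₂)) g₂ c₂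
          ∘ₗ resS S₂ :=
  R325_dirichlet_indep_lattice τ bonds cb hcb Ω₁ wT BT ΓT yT hsing S₁ S₂ hΩ₁ hΩ₂ hlayer₁ hlayer₂ _ _
    (qL_ker_iff_of_compat S₁ τ wT BT ΓT yT w₁ B₁ Γ₁ y₁ ι₁ hB₁ hw₁ hΓ₁ hy₁ hoff₁)
    (qL_ker_iff_of_compat S₂ τ wT BT ΓT yT w₂ B₂ Γ₂ y₂ ι₂ hB₂ hw₂ hΓ₂ hy₂ hoff₂) h₁ h₂

end Lattice

/-! ## §6  The exponent of (3.20), «(3.17) = exp(−(1/2α)‖RD*A‖²)», read on T_η (v1.1, append-only) -/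

section Density

/-- ‖Ω₀λ‖_{L²(T_η,𝔤)} = ‖λ‖_{L²(Ω₀,𝔤)}: extension by zero is an isometry.
[cite: Balaban1985BackgroundPropagators, (3.23) p. 394] -/
theorem norm_extS (f : PiLp 2 (fun _ : ↥S => V)) : ‖extS S f‖ = ‖f‖ := by
  rw [norm_eq_sqrt_real_inner (extS S f), norm_eq_sqrt_real_inner f, inner_extS_left, resS_extS]

variable [FiniteDimensional ℝ V] (ΔT : PiLp 2 (fun _ : Xt => V) →ₗ[ℝ] PiLp 2 (fun _ : Xt => V))
  {F : Type*} [NormedAddCommGroup F] [InnerProductSpace ℝ F] (q : PiLp 2 (fun _ : ↥S => V) →ₗ[ℝ] F)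

/-- **‖R(f↾Ω₀)‖_{L²(Ω₀,𝔤)} = ‖P_{Δ_T(Ω₀N(Q′))} f‖_{L²(T_η,𝔤)}**: the norm entering the exponent of (3.20) — there with
f = D\*A, «The norm ‖·‖ in (3.17) is determined by the scalar product … in the Hilbert space L²(Ω₀, 𝔤)» (p. 393) —
computed with the auxiliary domain Ω₀ and its Dirichlet operator, is the T_η-quantity ‖P f‖ with P the orthogonal
projection onto Δ_T(Ω₀N(Q′)). [cite: Balaban1985BackgroundPropagators, (3.17) p. 393, (3.20)+(3.25) p. 394] -/
theorem norm_R325_resS_dirichlet {qs : F →ₗ[ℝ] PiLp 2 (fun _ : ↥S => V)} {A : F →ₗ[ℝ] F}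
    {g : PiLp 2 (fun _ : ↥S => V) →ₗ[ℝ] PiLp 2 (fun _ : ↥S => V)} {c : F →ₗ[ℝ] F}
    (h : Data (resS S ∘ₗ ΔT ∘ₗ extS S) q qs A g c)
    (hloc : ∀ l : PiLp 2 (fun _ : ↥S => V), q l = 0 → ∀ z, z ∉ S → ΔT (extS S l) z = 0)
    (f : PiLp 2 (fun _ : Xt => V)) :
    ‖R325 q qs g c (resS S f)‖ = ‖(((LinearMap.ker q).map (extS S)).map ΔT).starProjection f‖ := by
  have h1 := congrArg (fun T : PiLp 2 (fun _ : Xt => V) →ₗ[ℝ] PiLp 2 (fun _ : Xt => V) => T f)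
    (extS_R325_resS_dirichlet S ΔT q h hloc)
  simp only [LinearMap.comp_apply, ContinuousLinearMap.coe_coe] at h1
  rw [← norm_extS S, h1]

/-- **The exponent of (3.20) does not depend on Ω₀**: two admissible domains (as in
`R325_dirichlet_indep_of_constraints`) give ‖R(f↾Ω₀)‖ = ‖R′(f↾Ω₀′)‖ for every f on T_η.
[cite: Balaban1985BackgroundPropagators, (3.20)+(3.25) p. 394] -/
theorem norm_R325_resS_indep_of_constraints (S₁ S₂ : Finset Xt) {F₁ F₂ : Type*} [NormedAddCommGroup F₁]
    [InnerProductSpace ℝ F₁] [NormedAddCommGroup F₂] [InnerProductSpace ℝ F₂]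
    (q₁ : PiLp 2 (fun _ : ↥S₁ => V) →ₗ[ℝ] F₁) (q₂ : PiLp 2 (fun _ : ↥S₂ => V) →ₗ[ℝ] F₂)
    {F' : Type*} [AddCommGroup F'] [Module ℝ F'] (QT : PiLp 2 (fun _ : Xt => V) →ₗ[ℝ] F')
    (hsupp₁ : ∀ μ, QT μ = 0 → ∀ z, z ∉ S₁ → μ z = 0) (hsupp₂ : ∀ μ, QT μ = 0 → ∀ z, z ∉ S₂ → μ z = 0)
    (hker₁ : ∀ l, q₁ l = 0 ↔ QT (extS S₁ l) = 0) (hker₂ : ∀ l, q₂ l = 0 ↔ QT (extS S₂ l) = 0)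
    {qs₁ : F₁ →ₗ[ℝ] PiLp 2 (fun _ : ↥S₁ => V)} {A₁ : F₁ →ₗ[ℝ] F₁}
    {g₁ : PiLp 2 (fun _ : ↥S₁ => V) →ₗ[ℝ] PiLp 2 (fun _ : ↥S₁ => V)} {c₁ : F₁ →ₗ[ℝ] F₁}
    {qs₂ : F₂ →ₗ[ℝ] PiLp 2 (fun _ : ↥S₂ => V)} {A₂ : F₂ →ₗ[ℝ] F₂}
    {g₂ : PiLp 2 (fun _ : ↥S₂ => V) →ₗ[ℝ] PiLp 2 (fun _ : ↥S₂ => V)} {c₂ : F₂ →ₗ[ℝ] F₂}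
    (h₁ : Data (resS S₁ ∘ₗ ΔT ∘ₗ extS S₁) q₁ qs₁ A₁ g₁ c₁) (h₂ : Data (resS S₂ ∘ₗ ΔT ∘ₗ extS S₂) q₂ qs₂ A₂ g₂ c₂)
    (hloc₁ : ∀ l : PiLp 2 (fun _ : ↥S₁ => V), q₁ l = 0 → ∀ z, z ∉ S₁ → ΔT (extS S₁ l) z = 0)
    (hloc₂ : ∀ l : PiLp 2 (fun _ : ↥S₂ => V), q₂ l = 0 → ∀ z, z ∉ S₂ → ΔT (extS S₂ l) z = 0)
    (f : PiLp 2 (fun _ : Xt => V)) :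
    ‖R325 q₁ qs₁ g₁ c₁ (resS S₁ f)‖ = ‖R325 q₂ qs₂ g₂ c₂ (resS S₂ f)‖ := by
  have h := congrArg (fun T : PiLp 2 (fun _ : Xt => V) →ₗ[ℝ] PiLp 2 (fun _ : Xt => V) => T f)
    (R325_dirichlet_indep_of_constraints ΔT S₁ S₂ q₁ q₂ QT hsupp₁ hsupp₂ hker₁ hker₂ h₁ h₂ hloc₁ hloc₂)
  simp only [LinearMap.comp_apply] at h
  rw [← norm_extS S₁, ← norm_extS S₂, h]

/-- **The exponent of (3.20) does not depend on Ω₀ — on the lattice** (hypotheses of `R325_dirichlet_indep_lattice`).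
[cite: Balaban1985BackgroundPropagators, (3.18) p. 393, (3.20)+(3.23)+(3.25) p. 394] -/
theorem norm_R325_resS_indep_lattice (τ : Xt → Xt → V →ₗ[ℝ] V) (bonds : Finset (Xt × Xt)) (cb : Xt × Xt → ℝ)
    (hcb : ∀ b ∈ bonds, 0 ≤ cb b) (Ω₁ : Finset Xt) {YT : Type*}
    (wT : YT → Xt → ℝ) (BT : YT → Finset Xt) (ΓT : YT → Xt → List Xt) (yT : YT → Xt)
    (hsing : ∀ x, x ∉ Ω₁ → ∃ cT, BT cT = {x} ∧ yT cT = x ∧ ΓT cT x = [] ∧ wT cT x ≠ 0)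
    (S₁ S₂ : Finset Xt) (hΩ₁ : Ω₁ ⊆ S₁) (hΩ₂ : Ω₁ ⊆ S₂)
    (hlayer₁ : ∀ b ∈ bonds, (b.1 ∈ Ω₁ → b.2 ∈ S₁) ∧ (b.2 ∈ Ω₁ → b.1 ∈ S₁))
    (hlayer₂ : ∀ b ∈ bonds, (b.1 ∈ Ω₁ → b.2 ∈ S₂) ∧ (b.2 ∈ Ω₁ → b.1 ∈ S₂))
    {F₁ F₂ : Type*} [NormedAddCommGroup F₁] [InnerProductSpace ℝ F₁] [NormedAddCommGroup F₂]
    [InnerProductSpace ℝ F₂] (q₁ : PiLp 2 (fun _ : ↥S₁ => V) →ₗ[ℝ] F₁) (q₂ : PiLp 2 (fun _ : ↥S₂ => V) →ₗ[ℝ] F₂)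
    (hker₁ : ∀ l, q₁ l = 0 ↔ qL τ wT BT ΓT yT (extS S₁ l) = 0)
    (hker₂ : ∀ l, q₂ l = 0 ↔ qL τ wT BT ΓT yT (extS S₂ l) = 0)
    {qs₁ : F₁ →ₗ[ℝ] PiLp 2 (fun _ : ↥S₁ => V)} {A₁ : F₁ →ₗ[ℝ] F₁}
    {g₁ : PiLp 2 (fun _ : ↥S₁ => V) →ₗ[ℝ] PiLp 2 (fun _ : ↥S₁ => V)} {c₁ : F₁ →ₗ[ℝ] F₁}
    {qs₂ : F₂ →ₗ[ℝ] PiLp 2 (fun _ : ↥S₂ => V)} {A₂ : F₂ →ₗ[ℝ] F₂}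
    {g₂ : PiLp 2 (fun _ : ↥S₂ => V) →ₗ[ℝ] PiLp 2 (fun _ : ↥S₂ => V)} {c₂ : F₂ →ₗ[ℝ] F₂}
    (h₁ : Data (resS S₁ ∘ₗ lapL τ bonds cb ∘ₗ extS S₁) q₁ qs₁ A₁ g₁ c₁)
    (h₂ : Data (resS S₂ ∘ₗ lapL τ bonds cb ∘ₗ extS S₂) q₂ qs₂ A₂ g₂ c₂) (f : PiLp 2 (fun _ : Xt => V)) :
    ‖R325 q₁ qs₁ g₁ c₁ (resS S₁ f)‖ = ‖R325 q₂ qs₂ g₂ c₂ (resS S₂ f)‖ := by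
  have h := congrArg (fun T : PiLp 2 (fun _ : Xt => V) →ₗ[ℝ] PiLp 2 (fun _ : Xt => V) => T f)
    (R325_dirichlet_indep_lattice τ bonds cb hcb Ω₁ wT BT ΓT yT hsing S₁ S₂ hΩ₁ hΩ₂ hlayer₁ hlayer₂ q₁ q₂
      hker₁ hker₂ h₁ h₂)
  simp only [LinearMap.comp_apply] at h
  rw [← norm_extS S₁, ← norm_extS S₂, h]

end Density

end Literature.MathematicalPhysics.QuantumFieldTheory.Balaban1983to89.B9Eq321DirichletIndependence
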